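import Literature.Probability.Percolation.AdjDihedral
import HarnessLib

/-!
# The six frames read from a rotated configuration

Topic `Literature/Probability/Percolation`; family `crit-perc` / near-critical percolation on `𝕋`.
A brick of the near-critical arm-separation theorem for four arms in the ADJACENT colour
arrangement (P. Nolin, EJP 13 (2008), Thm. 11, `j = 4`, `σ = BBWW` [arXiv 0711.4948: Thm. 10]),
landing step with a per-slot rotation `r` (`AdjDihedral.lean`): the exits of `ω` are described in
the six framed configurations `frameConfig i ω`; the corridors live in the rotated configuration
`ω' = rotConfig r ω`. The composition table: `frameConfig i ω` is the rotated reading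
`rotConfig a ω'` (`i = 0, 1, 3, 4`, `a = 6 - r, 7 - r, 9 - r, 10 - r (mod 6)`) or the reflected
reading `rswConfig a ω'` (`i = 2, 5`, `a = 6 - r, 9 - r (mod 6)`), and correspondingly
`frameIso i = ρ^r ∘ ρ^a` or `ρ^r ∘ (ρ^a ∘ σ)` on sites (`frameConfig_eq_reading`,
`frameIso_eq_reading`). Everything here is proved.

## References

* P. Nolin, Near-critical percolation in two dimensions, *Electron. J. Probab.* 13 (2008), §4.4
  (arXiv 0711.4948: proof of Thm. 10) [Nolin2008].
-/

noncomputable section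

open Set

namespace Literature.Probability.Percolation

open LatticeModels

/-- **The reading of the frame `i` from the rotated configuration**, in terms of `r' = r mod 6`:
rotated (`false`) or reflected (`true`), and the index `a` of the reading. [folklore] -/
def frameReading' (i r' : ℕ) : Bool × ℕ :=
  match i with
  | 0 => (false, (6 - r') % 6)
  | 1 => (false, (7 - r') % 6)
  | 2 => (true, (6 - r') % 6)
  | 3 => (false, (9 - r') % 6)
  | 4 => (false, (10 - r') % 6)
  | 5 => (true, (9 - r') % 6)
  | _ => (false, (6 - r') % 6)

/-- **The reading of the frame `i` from the `r`-rotated configuration.** [folklore] -/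
def frameReading (i r : ℕ) : Bool × ℕ := frameReading' i (r % 6)

/-- The reading index is `< 6`. [folklore] -/
theorem frameReading_snd_lt (i r : ℕ) : (frameReading i r).2 < 6 := by
  unfold frameReading frameReading'; split <;> exact Nat.mod_lt _ (by norm_num)

/-- The site map of a reading: `ρ^a` or `ρ^a ∘ σ`. [folklore] -/
def readingIso (b : Bool) (a : ℕ) : triGraph ≃g triGraph := bif b then rswIso a else triRotIsoPow a

/-- `readingIso false a = ρ^a`. [folklore] -/
@[simp] theorem readingIso_false (a : ℕ) (v : Site 2) : readingIso false a v = triRotIsoPow a v := rfl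

/-- `readingIso true a = ρ^a ∘ σ`. [folklore] -/
@[simp] theorem readingIso_true (a : ℕ) (v : Site 2) : readingIso true a v = rswIso a v := rfl

/-- `ρ^3 = -id` on sites (a private copy of the tree's `triRotIsoPow_three_apply` of
`ArmSeparationFourArmProofs.lean`, to keep the imports light). [folklore] -/
private theorem triRotIsoPow_three_apply' (v : Site 2) : triRotIsoPow 3 v = -v := by
  obtain ⟨-, -, -, -, -, -, h0, h1, -⟩ := rot_apply_formula v
  ext j; fin_cases j
  · simp [h0]
  · simp [h1]

/-- **The frame map factors through the rotation**: `frameIso i v = ρ^r (readingIso b a v)` with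
`(b, a) = frameReading i r` (`i < 6`). [folklore] -/
theorem frameIso_eq_reading {i : ℕ} (hi : i < 6) (r : ℕ) (v : Site 2) :
    frameIso i v = triRotIsoPow r (readingIso (frameReading i r).1 (frameReading i r).2 v) := by
  rw [← triRotIsoPow_mod_six_apply r]
  unfold frameReading
  have hr : r % 6 < 6 := Nat.mod_lt _ (by norm_num)
  generalize r % 6 = r' at hr ⊢
  interval_cases i <;> interval_cases r' <;>
    simp only [frameReading', readingIso_false, readingIso_true, rswIso_apply, ← triRotIsoPow_add_apply,
      Nat.reduceSub, Nat.reduceMod, Nat.reduceAdd] <;>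
    first
    | rfl
    | (rw [← triRotIsoPow_mod_six_apply]; simp only [Nat.reduceMod]; first
        | rfl
        | (rw [triRotIsoPow_three_apply']; rfl))

/-- **The framed configuration is a reading of the rotated configuration**:
`frameConfig i ω = (rotConfig a | rswConfig a) (rotConfig r ω)`. [folklore] -/
theorem frameConfig_eq_reading {i : ℕ} (hi : i < 6) (r : ℕ) (ω : SiteConfig (Site 2)) :
    frameConfig i ω = (bif (frameReading i r).1 then rswConfig (frameReading i r).2 (rotConfig r ω)
      else rotConfig (frameReading i r).2 (rotConfig r ω)) := by
  ext v
  rw [mem_frameConfig, frameIso_eq_reading hi r v]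
  cases (frameReading i r).1
  · simp only [cond_false, mem_rotConfig, readingIso_false]
  · simp only [cond_true, mem_rswConfig, mem_rotConfig, readingIso_true]

end Literature.Probability.Percolation
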